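import Summits.Parity.BatemanHorn.Theorems.SelbergDelangeRigidityLSDRealSegmentTailsTwoSparseAux
import HarnessLib

/-!
# Route `SelbergDelangeRigidity`, crux `LSDRealSegment` (stmt-Parity-9770), line
# `product-anatomy-subcritical`: the sparse slices carry negligible weight (`stub_tailsTwo`)

THE PLACE WHERE (R) IS CONSUMED.  In the small-prime restoration of `stub_tailsTwo` the slices `s` (exact
`P`-smooth parts of the values) with `lcm(s) > X^{1−θ}` are not reached by Nair–Tenenbaum; they are SPARSE:
by `tailsTwo_smoothPart_prodVal_le` (Bugeaud–Evertse–Győry, `p`-adic Roth) `∏ sᵢ ≤ C N^{1+2θ}`, so the small-prime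
tilt of a member of such a slice is `y^{Ω(∏ sᵢ)} ≤ (C N^{1+2θ})^{log₂ y}` with `log₂ y < 1`; a slice meets a block
`(X, N]` (`N ≤ 2X`) in `≤ ρ_F(lcm s)(X/lcm s + 1) ≪ X^θ` points; and there are only `(log X)^{O(1)}` slices
(few smooth numbers).  Hence (`tailsTwo_sparse`, registered helper) for ANY non-negative weights `Fᵢ(m) ≤ B m^{ε₁}`
the sparse slices carry total weight `≤ X^{1−θ}` once `θ ≤ (1 − log₂ y)/6`, `ε₁ ≤ θ/(2k+2)`, `X ≥ X₀`.
-/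

open Filter Finset Polynomial
open scoped BigOperators Topology Classical

namespace Summit.Parity.BatemanHorn.Cruxes.LSDRealSegment.ProductAnatomySubcritical

open Literature.NumberTheory.Sieve
open Literature.NumberTheory.DiophantineApproximation
open ArithmeticFunction (cardFactors)
noncomputable section

variable {k : ℕ}

/-- A constant times a power of `A + 4 log X` is eventually `≤ X^θ` (`θ > 0`). [folklore] -/
theorem eventually_mul_log_pow_le_rpow {K A θ : ℝ} (hK : 0 ≤ K) (hA0 : 0 ≤ A) (c : ℕ) (hθ : 0 < θ) :
    ∀ᶠ X : ℕ in atTop, K * (A + 4 * Real.log X) ^ c ≤ (X : ℝ) ^ θ := by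
  have hε : (0 : ℝ) < 1 / (K * 5 ^ c + 1) := by positivity
  have h1 : ∀ᶠ x : ℝ in atTop, ‖Real.log x ^ (c : ℝ)‖ ≤ 1 / (K * 5 ^ c + 1) * ‖x ^ θ‖ :=
    (isLittleO_log_rpow_rpow_atTop (c : ℝ) hθ).bound hε
  have h2 : ∀ᶠ x : ℝ in atTop, A ≤ Real.log x := Real.tendsto_log_atTop.eventually_ge_atTop A
  have h3 : ∀ᶠ x : ℝ in atTop, (1 : ℝ) ≤ x := eventually_ge_atTop 1
  have h := (h1.and (h2.and h3))
  filter_upwards [tendsto_natCast_atTop_atTop.eventually h] with X hX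
  obtain ⟨hb, hA, hX1⟩ := hX
  have hlog : 0 ≤ Real.log X := Real.log_nonneg hX1
  rw [Real.rpow_natCast, Real.norm_of_nonneg (pow_nonneg hlog c),
    Real.norm_of_nonneg (Real.rpow_nonneg (by linarith) θ)] at hb
  have h4 : (A + 4 * Real.log X) ^ c ≤ (5 * Real.log X) ^ c :=
    pow_le_pow_left₀ (by linarith) (by linarith) c
  have hXθ : 0 ≤ (X : ℝ) ^ θ := Real.rpow_nonneg (by linarith) θ
  calc K * (A + 4 * Real.log X) ^ c ≤ K * (5 * Real.log X) ^ c := mul_le_mul_of_nonneg_left h4 hK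
    _ = K * 5 ^ c * Real.log X ^ c := by rw [mul_pow]; ring
    _ ≤ K * 5 ^ c * (1 / (K * 5 ^ c + 1) * (X : ℝ) ^ θ) := mul_le_mul_of_nonneg_left hb (by positivity)
    _ = (K * 5 ^ c / (K * 5 ^ c + 1)) * (X : ℝ) ^ θ := by ring
    _ ≤ 1 * (X : ℝ) ^ θ := by
        refine mul_le_mul_of_nonneg_right ?_ hXθ
        rw [div_le_one (by positivity)]
        linarith
    _ = (X : ℝ) ^ θ := one_mul _

/-- The tuple of smooth parts of a member of a block lies in the box of `P`-smooth tuples `≤ V`. [folklore] -/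
theorem smoothParts_mem_piFinset {f : Fin k → ℤ[X]} {P V n : ℕ} (hV : ∀ i, val f i n ≤ V) :
    (fun i => smoothPart (P : ℝ) (val f i n)) ∈
      Fintype.piFinset fun _ : Fin k => (Icc 1 V).filter fun m : ℕ => ∀ p ∈ m.primeFactors, p ≤ P := by
  refine Fintype.mem_piFinset.mpr fun i => Finset.mem_filter.mpr ⟨Finset.mem_Icc.mpr ⟨?_, ?_⟩, fun p hp => ?_⟩
  · exact Nat.one_le_iff_ne_zero.mpr (smoothPart_ne_zero _ _)
  · exact (smoothPart_le _ (by rw [val]; positivity)).trans (hV i)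
  · exact_mod_cast le_of_mem_primeFactors_smoothPart hp

/-- **One weight on a sparse slice**: `∏ᵢ y^{Ω(sᵢ)} Fᵢ(fᵢ(n)) ≤ 4 C_B^λ X^{λ+2θ} · (B+1)^k (4H)^{θ/2} X^θ` for a member
`n ≤ N ≤ 2X` of a block whose smooth parts have product `≤ C_B n^{1+2θ}` (`λ = log₂ y`, `Fᵢ(m) ≤ B m^{ε₁}`,
values `≤ H N²`, `ε₁ ≤ θ/(2k+2)`). [folklore] -/
theorem sparse_weight_le {f : Fin k → ℤ[X]} {y θ ε₁ B CB : ℝ} {P Hv X N n : ℕ} (hy : 1 ≤ y) (hy2 : y < 2) (hθ : 0 < θ)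
    (hθl : θ ≤ (1 - Real.logb 2 y) / 6) (hε₁θ : ε₁ ≤ θ / (2 * k + 2)) (hB : 0 ≤ B) (hCB0 : 0 < CB) (hHv1 : 1 ≤ Hv) (hX1 : 1 ≤ X)
    (hn1 : 1 ≤ n) (hnN : n ≤ N) (hN2 : N ≤ 2 * X) (hval : ∀ i, val f i n ≤ Hv * N ^ 2)
    (hCB : (∏ i, (smoothPart (P : ℝ) (val f i n) : ℝ)) ≤ CB * (max 1 (n : ℝ)) ^ (1 + 2 * θ))
    {F : Fin k → ℕ → ℝ} (hF0 : ∀ i m, 0 ≤ F i m) (hFB : ∀ i m, 1 ≤ m → F i m ≤ B * (m : ℝ) ^ ε₁) :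
    ∏ i, (y ^ cardFactors (smoothPart (P : ℝ) (val f i n)) * F i (val f i n)) ≤
      (CB ^ Real.logb 2 y * 4) * (X : ℝ) ^ (Real.logb 2 y + 2 * θ) *
        ((B + 1) ^ k * ((4 * Hv : ℝ) ^ (θ / 2) * (X : ℝ) ^ θ)) := by
  set lam : ℝ := Real.logb 2 y with hlam
  have hlam0 : 0 ≤ lam := Real.logb_nonneg one_lt_two hy
  have hlam1 : lam ≤ 1 := by
    rw [hlam, Real.logb_le_iff_le_rpow one_lt_two (by linarith), Real.rpow_one]
    linarith
  have hy0 : 0 ≤ y := by linarith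
  have hXr : (1 : ℝ) ≤ X := by exact_mod_cast hX1
  have hXpos : (0 : ℝ) < X := by linarith
  have hNr : (N : ℝ) ≤ 2 * X := by exact_mod_cast hN2
  have hHv4 : (1 : ℝ) ≤ 4 * Hv := by
    have : (1 : ℝ) ≤ Hv := by exact_mod_cast hHv1
    linarith
  have hval1 : ∀ i, 1 ≤ val f i n := fun i => by rw [val]; exact le_max_right _ _
  have hvalr : ∀ i, (val f i n : ℝ) ≤ 4 * Hv * (X : ℝ) ^ 2 := fun i => by
    calc (val f i n : ℝ) ≤ ((Hv * N ^ 2 : ℕ) : ℝ) := by exact_mod_cast hval i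
      _ = Hv * (N : ℝ) ^ 2 := by push_cast; ring
      _ ≤ Hv * (2 * X) ^ 2 := by gcongr
      _ = 4 * Hv * (X : ℝ) ^ 2 := by ring
  set sp : Fin k → ℕ := fun i => smoothPart (P : ℝ) (val f i n) with hsp
  -- the small-prime tilt
  have htilt : ∏ i, y ^ cardFactors (sp i) ≤ (CB ^ lam * 4) * (X : ℝ) ^ (lam + 2 * θ) := by
    have hsp0 : ∀ i, sp i ≠ 0 := fun i => smoothPart_ne_zero _ _
    rw [Finset.prod_pow_eq_pow_sum, ← cardFactors_finset_prod _ _ fun i _ => hsp0 i]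
    have h1 := pow_cardFactors_le_rpow hy (m := ∏ i, sp i) (Finset.prod_ne_zero_iff.mpr fun i _ => hsp0 i)
    have h2 := hCB
    rw [max_eq_right (by exact_mod_cast hn1 : (1 : ℝ) ≤ n)] at h2
    have h3 : ((∏ i, sp i : ℕ) : ℝ) ≤ CB * (2 * X) ^ (1 + 2 * θ) := by
      push_cast
      exact h2.trans (mul_le_mul_of_nonneg_left (Real.rpow_le_rpow (Nat.cast_nonneg n)
        (le_trans (by exact_mod_cast hnN) hNr) (by linarith)) hCB0.le)
    calc y ^ cardFactors (∏ i, sp i) ≤ ((∏ i, sp i : ℕ) : ℝ) ^ lam := h1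
      _ ≤ (CB * (2 * X) ^ (1 + 2 * θ)) ^ lam := Real.rpow_le_rpow (Nat.cast_nonneg _) h3 hlam0
      _ = CB ^ lam * ((2 * X) ^ (1 + 2 * θ)) ^ lam := Real.mul_rpow hCB0.le (by positivity)
      _ = CB ^ lam * (2 * X) ^ ((1 + 2 * θ) * lam) := by rw [← Real.rpow_mul (by positivity)]
      _ ≤ CB ^ lam * (2 * X) ^ (lam + 2 * θ) := by
          refine mul_le_mul_of_nonneg_left (Real.rpow_le_rpow_of_exponent_le (by linarith) ?_) (by positivity)
          nlinarith
      _ = CB ^ lam * (2 ^ (lam + 2 * θ) * (X : ℝ) ^ (lam + 2 * θ)) := by rw [Real.mul_rpow (by norm_num) hXpos.le]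
      _ ≤ CB ^ lam * (4 * (X : ℝ) ^ (lam + 2 * θ)) := by
          refine mul_le_mul_of_nonneg_left (mul_le_mul_of_nonneg_right ?_ (by positivity)) (by positivity)
          have hθ1 : lam + 2 * θ ≤ 2 := by rw [hlam]; linarith
          calc (2 : ℝ) ^ (lam + 2 * θ) ≤ 2 ^ (2 : ℝ) := Real.rpow_le_rpow_of_exponent_le one_le_two hθ1
            _ = 4 := by norm_num
      _ = (CB ^ lam * 4) * (X : ℝ) ^ (lam + 2 * θ) := by ring
  -- the weights on the rough parts
  have hFle : ∏ i, F i (val f i n) ≤ (B + 1) ^ k * ((4 * Hv : ℝ) ^ (θ / 2) * (X : ℝ) ^ θ) := by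
    have hone : ∀ i, F i (val f i n) ≤ (B + 1) * ((4 * Hv : ℝ) * (X : ℝ) ^ 2) ^ (θ / (2 * k + 2)) := by
      intro i
      have hv1 : (1 : ℝ) ≤ val f i n := by exact_mod_cast hval1 i
      calc F i (val f i n) ≤ B * (val f i n : ℝ) ^ ε₁ := hFB i _ (hval1 i)
        _ ≤ (B + 1) * (val f i n : ℝ) ^ (θ / (2 * k + 2)) :=
            mul_le_mul (by linarith) (Real.rpow_le_rpow_of_exponent_le hv1 hε₁θ) (by positivity) (by linarith)
        _ ≤ (B + 1) * ((4 * Hv : ℝ) * (X : ℝ) ^ 2) ^ (θ / (2 * k + 2)) :=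
            mul_le_mul_of_nonneg_left (Real.rpow_le_rpow (by positivity) (hvalr i) (by positivity)) (by linarith)
    have e2 : (((4 * Hv : ℝ) * (X : ℝ) ^ 2) ^ (θ / (2 * k + 2))) ^ k =
        ((4 * Hv : ℝ) * (X : ℝ) ^ 2) ^ (θ / (2 * k + 2) * k) := by
      rw [← Real.rpow_natCast (((4 * Hv : ℝ) * (X : ℝ) ^ 2) ^ (θ / (2 * k + 2))) k, ← Real.rpow_mul (by positivity)]
    have e3 : ((4 * Hv : ℝ) * (X : ℝ) ^ 2) ^ (θ / 2) = (4 * Hv : ℝ) ^ (θ / 2) * (X : ℝ) ^ θ := by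
      rw [Real.mul_rpow (by positivity) (by positivity)]
      rw [← Real.rpow_natCast (X : ℝ) 2, ← Real.rpow_mul hXpos.le]
      congr 1
      push_cast
      ring
    have hexp : θ / (2 * k + 2) * k ≤ θ / 2 := by
      rw [div_mul_eq_mul_div, div_le_div_iff₀ (by positivity) (by positivity)]
      have hk0 : (0 : ℝ) ≤ k := Nat.cast_nonneg k
      nlinarith
    have hbase : (1 : ℝ) ≤ (4 * Hv : ℝ) * (X : ℝ) ^ 2 := by nlinarith
    calc ∏ i, F i (val f i n) ≤ ∏ _i : Fin k, (B + 1) * ((4 * Hv : ℝ) * (X : ℝ) ^ 2) ^ (θ / (2 * k + 2)) :=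
          Finset.prod_le_prod (fun i _ => hF0 i _) fun i _ => hone i
      _ = (B + 1) ^ k * ((4 * Hv : ℝ) * (X : ℝ) ^ 2) ^ (θ / (2 * k + 2) * k) := by
          rw [Finset.prod_const, Finset.card_univ, Fintype.card_fin, mul_pow, e2]
      _ ≤ (B + 1) ^ k * ((4 * Hv : ℝ) * (X : ℝ) ^ 2) ^ (θ / 2) :=
          mul_le_mul_of_nonneg_left (Real.rpow_le_rpow_of_exponent_le hbase hexp) (by positivity)
      _ = (B + 1) ^ k * ((4 * Hv : ℝ) ^ (θ / 2) * (X : ℝ) ^ θ) := by rw [e3]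
  calc ∏ i, (y ^ cardFactors (sp i) * F i (val f i n)) = (∏ i, y ^ cardFactors (sp i)) * ∏ i, F i (val f i n) :=
        Finset.prod_mul_distrib
    _ ≤ (CB ^ lam * 4) * (X : ℝ) ^ (lam + 2 * θ) * ((B + 1) ^ k * ((4 * Hv : ℝ) ^ (θ / 2) * (X : ℝ) ^ θ)) :=
        mul_le_mul htilt hFle (Finset.prod_nonneg fun i _ => hF0 i _) (by positivity)

/-- **A sparse slice meets a block in few points**: for a `P`-smooth tuple `s` with `lcm(s) > T = X^{1−θ}`, the
`n ∈ (X, N]` (`N ≤ 2X`, values `≥ 1`) with smooth parts `s` number `≤ 2 K X^θ`, `K = C^{π(P)}` a bound for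
`ρ_F` at `P`-smooth moduli (`lcm(s) ∣ ∏ fᵢ(n)`, complete periods). [folklore] -/
theorem sparse_count_le {f : Fin k → ℤ[X]} {C : ℕ} (hC : ∀ p : ℕ, p.Prime → ∀ a : ℕ, polyRootCountMod f (p ^ a) ≤ C)
    (hC1 : 1 ≤ C) {P X N : ℕ} {θ : ℝ} (hθ : 0 ≤ θ) (hX1 : 1 ≤ X) (hXN : X ≤ N) (hN2 : N ≤ 2 * X)
    (hpos : ∀ n, X < n → ∀ i, (1 : ℤ) ≤ (f i).eval (n : ℤ)) {s : Fin k → ℕ} (hs1 : ∀ i, s i ≠ 0)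
    (hsP : ∀ i, ∀ p ∈ (s i).primeFactors, p ≤ P) (hT : (X : ℝ) ^ (1 - θ) < ((Finset.univ.lcm s : ℕ) : ℝ)) :
    (#((Finset.Ioc X N).filter fun n => (fun i => smoothPart (P : ℝ) (val f i n)) = s) : ℝ) ≤
      2 * (C : ℝ) ^ (Nat.primesLE P).card * (X : ℝ) ^ θ := by
  set L := Finset.univ.lcm s with hL
  set Kρ : ℕ := C ^ (Nat.primesLE P).card with hKρ
  have hL0 : L ≠ 0 := univ_lcm_ne_zero hs1
  have hXr : (1 : ℝ) ≤ X := by exact_mod_cast hX1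
  have hXpos : (0 : ℝ) < X := by linarith
  -- members of the slice satisfy `L ∣ ∏ fⱼ(n)`
  have hsub : (Finset.Ioc X N).filter (fun n => (fun i => smoothPart (P : ℝ) (val f i n)) = s) ⊆
      (Finset.Ico (X + 1) (X + 1 + (N - X))).filter (fun n : ℕ => (L : ℤ) ∣ ∏ j, (f j).eval (n : ℤ)) := by
    intro n hn
    rw [Finset.mem_filter, Finset.mem_Ioc] at hn
    obtain ⟨⟨hXn, hnN⟩, hns⟩ := hn
    have hp := hpos n hXn
    rw [Finset.mem_filter, Finset.mem_Ico]
    refine ⟨⟨by omega, by omega⟩, ?_⟩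
    have h1 : ∀ i, ((s i : ℕ) : ℤ) ∣ ∏ j, (f j).eval (n : ℤ) := fun i => by
      refine (Int.natCast_dvd.mpr ?_).trans (Finset.dvd_prod_of_mem (fun j => (f j).eval (n : ℤ)) (Finset.mem_univ i))
      rw [← val_eq_natAbs hp i, ← congr_fun hns i]
      exact smoothPart_dvd _ _
    have : L ∣ (∏ j, (f j).eval (n : ℤ)).natAbs := Finset.lcm_dvd fun i _ => Int.natCast_dvd.mp (h1 i)
    rwa [← Int.natCast_dvd] at this
  have hper := abs_card_filter_Ico_sub_le (fun n : ℕ => (L : ℤ) ∣ ∏ j, (f j).eval (n : ℤ)) (Nat.pos_of_ne_zero hL0)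
    (periodic_dvd_prod_eval f L) (X + 1) (N - X)
  have hρ : polyRootCountMod f L ≤ Kρ := polyRootCountMod_smooth_le f hC hC1 hL0 (primeFactors_univ_lcm_le hs1 hsP)
  have hρ' : (#((Finset.range L).filter (fun n : ℕ => (L : ℤ) ∣ ∏ j, (f j).eval (n : ℤ))) : ℝ) ≤ Kρ := by
    exact_mod_cast hρ
  have hℓ : ((N - X : ℕ) : ℝ) ≤ X := by
    have : N - X ≤ X := by omega
    exact_mod_cast this
  have hLr : (0 : ℝ) < L := by exact_mod_cast Nat.pos_of_ne_zero hL0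
  have hXT : (X : ℝ) / L ≤ (X : ℝ) ^ θ := by
    rw [div_le_iff₀ hLr]
    calc (X : ℝ) = (X : ℝ) ^ θ * (X : ℝ) ^ (1 - θ) := by
          rw [← Real.rpow_add hXpos]
          norm_num
      _ ≤ (X : ℝ) ^ θ * L := mul_le_mul_of_nonneg_left hT.le (by positivity)
  have h1 : (1 : ℝ) ≤ (X : ℝ) ^ θ := Real.one_le_rpow hXr hθ
  have hK : (0 : ℝ) ≤ Kρ := Nat.cast_nonneg _
  calc (#((Finset.Ioc X N).filter fun n => (fun i => smoothPart (P : ℝ) (val f i n)) = s) : ℝ)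
      ≤ #((Finset.Ico (X + 1) (X + 1 + (N - X))).filter (fun n : ℕ => (L : ℤ) ∣ ∏ j, (f j).eval (n : ℤ))) := by
        exact_mod_cast Finset.card_le_card hsub
    _ ≤ ((N - X : ℕ) : ℝ) * #((Finset.range L).filter (fun n : ℕ => (L : ℤ) ∣ ∏ j, (f j).eval (n : ℤ))) / L +
          #((Finset.range L).filter (fun n : ℕ => (L : ℤ) ∣ ∏ j, (f j).eval (n : ℤ))) := by
        have := (abs_le.mp hper).2
        linarith
    _ ≤ (X : ℝ) * Kρ / L + Kρ := by gcongr
    _ = Kρ * ((X : ℝ) / L) + Kρ := by ring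
    _ ≤ Kρ * (X : ℝ) ^ θ + Kρ * (X : ℝ) ^ θ := by nlinarith [mul_le_mul_of_nonneg_left hXT hK]
    _ = 2 * (Kρ : ℝ) * (X : ℝ) ^ θ := by ring
    _ = 2 * (C : ℝ) ^ (Nat.primesLE P).card * (X : ℝ) ^ θ := by rw [hKρ]; push_cast; ring

/-- **tailsTwo_sparse** (registered helper of `stub_tailsTwo`, line `product-anatomy-subcritical`; CONDITIONAL on the
named fact (R) `BugeaudEvertseGyory2018_SPartPolynomialValues`): in a block `(X, N]`, `N ≤ 2X`, the members whose
tuple of exact `P`-smooth parts `s` has `lcm(s) > X^{1−θ}` carry total weight `≤ X^{1−θ}` under ANY weights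
`∏ᵢ y^{Ω(sᵢ)} Fᵢ(fᵢ(n))` with `0 ≤ Fᵢ(m) ≤ B m^{ε₁}` — for `1 ≤ y < 2`, `0 < θ ≤ (1 − log₂ y)/6`,
`0 < ε₁ ≤ θ/(2k+2)` and `X ≥ X₀(f, y, θ, ε₁, B, P)`. [folklore] -/
theorem tailsTwo_sparse : BugeaudEvertseGyory2018_SPartPolynomialValues →
    ∀ (k : ℕ) (f : Fin k → ℤ[X]), IsBatemanHornSystem f → (∑ i, (f i).natDegree) = 2 →
    ∀ (y θ ε₁ B : ℝ) (P : ℕ), 1 ≤ y → y < 2 → 0 < θ → θ ≤ (1 - Real.logb 2 y) / 6 → 0 < ε₁ →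
    ε₁ ≤ θ / (2 * k + 2) → 0 ≤ B →
    ∃ X₀ : ℕ, ∀ (F : Fin k → ℕ → ℝ), (∀ i m, 0 ≤ F i m) → (∀ i m, 1 ≤ m → F i m ≤ B * (m : ℝ) ^ ε₁) →
      ∀ X N : ℕ, X₀ ≤ X → X ≤ N → N ≤ 2 * X →
        (∑ n ∈ (Finset.Ioc X N).filter (fun n => (X : ℝ) ^ (1 - θ) <
            ((Finset.univ.lcm fun i => smoothPart (P : ℝ) (val f i n) : ℕ) : ℝ)),
          ∏ i, (y ^ cardFactors (smoothPart (P : ℝ) (val f i n)) * F i (val f i n))) ≤ (X : ℝ) ^ (1 - θ) := by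
  intro hBEG k f hf hdeg y θ ε₁ B P hy hy2 hθ hθl hε₁ hε₁θ hB
  set lam : ℝ := Real.logb 2 y with hlam
  have hy0 : 0 ≤ y := by linarith
  -- data of the system
  obtain ⟨n₀, hn₀⟩ := exists_forall_one_le_eval hf
  obtain ⟨Cρ, hCρ⟩ := exists_polyRootCountMod_prime_pow_le_of_system hf
  obtain ⟨Hv, hHv1, hHv⟩ := val_le_of_sum_natDegree (f := f) hdeg
  obtain ⟨CB, hCB0, hCB⟩ := tailsTwo_smoothPart_prodVal_le hBEG k f hf hdeg P θ hθ
  set c : ℕ := (Nat.primesLE P).card * k with hc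
  set Kρ : ℝ := 2 * ((max Cρ 1 : ℕ) : ℝ) ^ (Nat.primesLE P).card with hKρ
  set K : ℝ := Kρ * ((CB ^ lam * 4) * ((B + 1) ^ k * (4 * Hv : ℝ) ^ (θ / 2))) with hK
  have hK0 : 0 ≤ K := by positivity
  have hHv4 : 0 ≤ Real.log (4 * Hv) :=
    Real.log_nonneg (by linarith [show (1 : ℝ) ≤ Hv from by exact_mod_cast hHv1])
  -- eventual conditions
  have ev1 := eventually_mul_log_pow_le_rpow (A := 2 * Real.log (4 * Hv) + 2) hK0 (by positivity) c hθ
  obtain ⟨X₀, hX₀⟩ := Filter.eventually_atTop.mp (ev1.and ((eventually_ge_atTop n₀).and (eventually_ge_atTop 1)))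
  refine ⟨X₀, fun F hF0 hFB X N hX hXN hN2 => ?_⟩
  obtain ⟨hpoly, hXn₀, hX1⟩ := hX₀ X hX
  have hXr : (1 : ℝ) ≤ X := by exact_mod_cast hX1
  have hXpos : (0 : ℝ) < X := by linarith
  have hpos : ∀ n, X < n → ∀ i, (1 : ℤ) ≤ (f i).eval (n : ℤ) := fun n hn => hn₀ n (by omega)
  set V : ℕ := Hv * N ^ 2 with hVdef
  have hV1 : 1 ≤ V := Nat.one_le_iff_ne_zero.mpr (mul_ne_zero (by omega) (pow_ne_zero _ (by omega)))
  have hVr : (V : ℝ) ≤ 4 * Hv * (X : ℝ) ^ 2 := by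
    have hNr : (N : ℝ) ≤ 2 * X := by exact_mod_cast hN2
    calc (V : ℝ) = Hv * (N : ℝ) ^ 2 := by rw [hVdef]; push_cast; ring
      _ ≤ Hv * (2 * X) ^ 2 := by gcongr
      _ = 4 * Hv * (X : ℝ) ^ 2 := by ring
  set sp : ℕ → Fin k → ℕ := fun n i => smoothPart (P : ℝ) (val f i n) with hsp
  set W : ℕ → ℝ := fun n => ∏ i, (y ^ cardFactors (smoothPart (P : ℝ) (val f i n)) * F i (val f i n)) with hW
  have hW0 : ∀ n, 0 ≤ W n := fun n => Finset.prod_nonneg fun i _ => mul_nonneg (pow_nonneg hy0 _) (hF0 i _)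
  set S := (Finset.Ioc X N).filter (fun n => (X : ℝ) ^ (1 - θ) <
    ((Finset.univ.lcm fun i => smoothPart (P : ℝ) (val f i n) : ℕ) : ℝ)) with hS
  set 𝒯 := Fintype.piFinset fun _ : Fin k => (Icc 1 V).filter fun m : ℕ => ∀ p ∈ m.primeFactors, p ≤ P with h𝒯
  set Wmax : ℝ := (CB ^ lam * 4) * (X : ℝ) ^ (lam + 2 * θ) * ((B + 1) ^ k * ((4 * Hv : ℝ) ^ (θ / 2) * (X : ℝ) ^ θ))
    with hWmax
  have hmemS : ∀ n ∈ S, X < n ∧ n ≤ N ∧ (X : ℝ) ^ (1 - θ) < ((Finset.univ.lcm (sp n) : ℕ) : ℝ) := by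
    intro n hn
    rw [hS, Finset.mem_filter, Finset.mem_Ioc] at hn
    exact ⟨hn.1.1, hn.1.2, hn.2⟩
  -- (1) the uniform bound on one weight
  have hWle : ∀ n ∈ S, W n ≤ Wmax := by
    intro n hn
    obtain ⟨hXn, hnN, -⟩ := hmemS n hn
    exact sparse_weight_le hy hy2 hθ hθl hε₁θ hB hCB0 hHv1 hX1 (by omega) hnN hN2 (fun i => hHv i n N (by omega) hnN)
      (hCB n (hpos n hXn)) hF0 hFB
  -- (2) every fibre is small
  have hcount : ∀ s ∈ 𝒯, ∑ n ∈ S.filter (fun n => sp n = s), W n ≤ Kρ * (X : ℝ) ^ θ * Wmax := by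
    intro s hs
    rw [h𝒯, Fintype.mem_piFinset] at hs
    have hs1 : ∀ i, s i ≠ 0 := fun i => by have := (Finset.mem_Icc.mp (Finset.mem_filter.mp (hs i)).1).1; omega
    have hsP : ∀ i, ∀ p ∈ (s i).primeFactors, p ≤ P := fun i => (Finset.mem_filter.mp (hs i)).2
    by_cases hTL : (X : ℝ) ^ (1 - θ) < ((Finset.univ.lcm s : ℕ) : ℝ)
    · have hc := sparse_count_le (f := f) (fun p hp a => (hCρ p hp a).trans (le_max_left _ 1)) (le_max_right _ _)
        (P := P) hθ.le hX1 hXN hN2 hpos hs1 hsP hTL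
      have hsub : S.filter (fun n => sp n = s) ⊆ (Finset.Ioc X N).filter (fun n => sp n = s) :=
        Finset.filter_subset_filter _ (Finset.filter_subset _ _)
      calc ∑ n ∈ S.filter (fun n => sp n = s), W n ≤ ∑ n ∈ S.filter (fun n => sp n = s), Wmax :=
            Finset.sum_le_sum fun n hn => hWle n (Finset.mem_filter.mp hn).1
        _ = #(S.filter fun n => sp n = s) * Wmax := by rw [Finset.sum_const, nsmul_eq_mul]
        _ ≤ #((Finset.Ioc X N).filter fun n => sp n = s) * Wmax := by
            gcongr
        _ ≤ Kρ * (X : ℝ) ^ θ * Wmax := by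
            refine mul_le_mul_of_nonneg_right ?_ (by positivity)
            rw [hKρ]
            simpa [hsp, mul_assoc] using hc
    · have : S.filter (fun n => sp n = s) = ∅ := by
        refine Finset.filter_false_of_mem fun n hn hns => hTL ?_
        have := (hmemS n hn).2.2
        rwa [hns] at this
      rw [this, Finset.sum_empty]
      positivity
  -- (3) assemble
  have hfiber : ∑ n ∈ S, W n = ∑ s ∈ 𝒯, ∑ n ∈ S.filter (fun n => sp n = s), W n := by
    refine (Finset.sum_fiberwise_of_maps_to (fun n hn => ?_) _).symm
    obtain ⟨hXn, hnN, -⟩ := hmemS n hn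
    exact smoothParts_mem_piFinset fun i => hHv i n N (by omega) hnN
  have hcard𝒯 : (#𝒯 : ℝ) ≤ (2 * Real.log (4 * Hv) + 2 + 4 * Real.log X) ^ c := by
    have h1 : #𝒯 ≤ ((Nat.log 2 V + 1) ^ (Nat.primesLE P).card) ^ k := by
      rw [h𝒯, Fintype.card_piFinset, Finset.prod_const, Finset.card_univ, Fintype.card_fin]
      exact Nat.pow_le_pow_left (card_smooth_le V P) k
    have h2 : ((Nat.log 2 V : ℕ) : ℝ) + 1 ≤ 2 * Real.log (4 * Hv) + 2 + 4 * Real.log X := by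
      have hlogV : ((Nat.log 2 V : ℕ) : ℝ) ≤ Real.logb 2 V := Real.natLog_le_logb V 2
      have hV0 : (0 : ℝ) < V := by exact_mod_cast hV1
      have hlV0 : 0 ≤ Real.log V := Real.log_nonneg (by exact_mod_cast hV1)
      have hlb : Real.logb 2 V ≤ 2 * Real.log V := by
        rw [Real.logb, div_le_iff₀ (Real.log_pos one_lt_two)]
        have hl2 : (1 : ℝ) / 2 < Real.log 2 := by have := Real.log_two_gt_d9; linarith
        nlinarith
      have hlV : Real.log V ≤ Real.log (4 * Hv) + 2 * Real.log X := by
        have hHv0 : (0 : ℝ) < 4 * Hv := by linarith [show (1 : ℝ) ≤ Hv from by exact_mod_cast hHv1]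
        calc Real.log V ≤ Real.log (4 * Hv * (X : ℝ) ^ 2) := Real.log_le_log hV0 hVr
          _ = Real.log (4 * Hv) + 2 * Real.log X := by
              rw [Real.log_mul hHv0.ne' (by positivity), Real.log_pow]; norm_num
      linarith
    calc (#𝒯 : ℝ) ≤ (((Nat.log 2 V + 1) ^ (Nat.primesLE P).card) ^ k : ℕ) := by exact_mod_cast h1
      _ = (((Nat.log 2 V : ℕ) : ℝ) + 1) ^ c := by rw [hc, pow_mul]; push_cast; ring
      _ ≤ (2 * Real.log (4 * Hv) + 2 + 4 * Real.log X) ^ c := pow_le_pow_left₀ (by positivity) h2 c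
  have hlam1 : lam ≤ 1 := by
    rw [hlam, Real.logb_le_iff_le_rpow one_lt_two (by linarith), Real.rpow_one]
    linarith
  have hexp : (X : ℝ) ^ (lam + 2 * θ) * (X : ℝ) ^ θ * (X : ℝ) ^ θ * (X : ℝ) ^ θ ≤ (X : ℝ) ^ (1 - θ) := by
    rw [← Real.rpow_add hXpos, ← Real.rpow_add hXpos, ← Real.rpow_add hXpos]
    exact Real.rpow_le_rpow_of_exponent_le hXr (by linarith)
  calc ∑ n ∈ S, W n = ∑ s ∈ 𝒯, ∑ n ∈ S.filter (fun n => sp n = s), W n := hfiber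
    _ ≤ ∑ s ∈ 𝒯, Kρ * (X : ℝ) ^ θ * Wmax := Finset.sum_le_sum hcount
    _ = #𝒯 * (Kρ * (X : ℝ) ^ θ * Wmax) := by rw [Finset.sum_const, nsmul_eq_mul]
    _ ≤ (2 * Real.log (4 * Hv) + 2 + 4 * Real.log X) ^ c * (Kρ * (X : ℝ) ^ θ * Wmax) :=
        mul_le_mul_of_nonneg_right hcard𝒯 (by positivity)
    _ = K * (2 * Real.log (4 * Hv) + 2 + 4 * Real.log X) ^ c *
          ((X : ℝ) ^ (lam + 2 * θ) * (X : ℝ) ^ θ * (X : ℝ) ^ θ) := by rw [hK, hWmax]; ring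
    _ ≤ (X : ℝ) ^ θ * ((X : ℝ) ^ (lam + 2 * θ) * (X : ℝ) ^ θ * (X : ℝ) ^ θ) :=
        mul_le_mul_of_nonneg_right hpoly (by positivity)
    _ = (X : ℝ) ^ (lam + 2 * θ) * (X : ℝ) ^ θ * (X : ℝ) ^ θ * (X : ℝ) ^ θ := by ring
    _ ≤ (X : ℝ) ^ (1 - θ) := hexp

end

end Summit.Parity.BatemanHorn.Cruxes.LSDRealSegment.ProductAnatomySubcritical
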